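import Mathlib
import Literature.NumberTheory.Transcendental.KZCalculus
import Literature.NumberTheory.Transcendental.MZVSimplexRep
import Literature.NumberTheory.Transcendental.EllIterRepShuffle

/-!
# `TateLifting` (stmt-KontsevichZagierPeriods-9129), line `Sketch` — stub 60 `CubeTriangulation`:
# the open cube is triangulated by the permuted open ordered simplices

The open cube `(0,1)ⁿ = Set.pi univ (Ioo 0 1)` is covered, up to the null walls `{xᵢ = xⱼ}`
(`i ≠ j`), by the `n!` pairwise disjoint permuted open ordered simplices
`P_σ Δ_n = (x ↦ P_σ x + 0) '' Δ_n = {y | y ∘ σ⁻¹ ∈ Δ_n}`, where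
`Δ_n = KZ.openOrderedSimplex n = {t | 0 < tᵢ < 1, t strictly decreasing}` and `P_σ` is the
permutation matrix (`Matrix.permMatrix_mulVec : P_σ v = v ∘ σ`). For an honest representation
`r` over the cube, the honest restrictions `R σ := r|_{P_σ Δ_n}` (`KZ.IntegralRep.restrict`,
same integrand) are therefore exactly the cover data consumed by the landed polytope sector
(iterated domain additivity, Kontsevich–Zagier rule (1)).

* `CubeTriangulation.mem_image_permMatrix_iff` — `y ∈ P_σ Δ_n ↔ y ∘ σ⁻¹ ∈ Δ_n`; hence the
  piece is the preimage of `Δ_n` under a coordinate permutation, `ℚ`-semialgebraic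
  (`IsSemialgebraic.preimage_comp`), and lies in the cube.
* `CubeTriangulation.exists_mem_image_permMatrix` — a point of the cube with pairwise distinct
  coordinates lies in the piece of (the inverse of) its decreasing sorting permutation
  (`Tuple.sort`, reversed by `Fin.rev`); so the cover defect lies in the finite union of the
  diagonal hyperplanes `{xᵢ = xⱼ}`, each Lebesgue-null (`KZ.volume_setOf_apply_eq_apply`).
* `CubeTriangulation.image_permMatrix_inter_eq_empty` — distinct permutations give DISJOINT
  pieces: the decreasing enumeration of a tuple with distinct entries is unique
  (`Tuple.unique_monotone`).
* `tateLifting_cubeTriangulation` — the registered stub.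

No definitions (pure proof file).

References: M. Kontsevich, D. Zagier, *Periods* (2001), §1.2 rule (1); J. Bochnak, M. Coste,
M.-F. Roy, *Real Algebraic Geometry* (1998), §2.1.
-/

open MeasureTheory Set
open Literature.NumberTheory.Transcendental
open Literature.ModelTheory.ExponentialFields (IsSemialgebraic)

namespace Summit.KontsevichZagierPeriods.InverseLandau

namespace CubeTriangulation

variable {n : ℕ}

/-- The affine map `x ↦ P_σ x + 0` of a permutation matrix is the coordinate permutation
`x ↦ x ∘ σ` (`Matrix.permMatrix_mulVec`). [folklore] -/
theorem permMatrix_mulVec_add_zero (σ : Equiv.Perm (Fin n)) (x : Fin n → ℝ) :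
    (Equiv.Perm.permMatrix ℝ σ : Matrix (Fin n) (Fin n) ℝ).mulVec x + 0 = x ∘ σ := by
  rw [add_zero, Matrix.permMatrix_mulVec]

/-- Membership in the permuted open ordered simplex: `y ∈ P_σ Δ_n ↔ y ∘ σ⁻¹ ∈ Δ_n`.
[folklore] -/
theorem mem_image_permMatrix_iff (σ : Equiv.Perm (Fin n)) (y : Fin n → ℝ) :
    y ∈ (fun x => (Equiv.Perm.permMatrix ℝ σ : Matrix (Fin n) (Fin n) ℝ).mulVec x + 0) ''
        KZ.openOrderedSimplex n ↔ y ∘ σ.symm ∈ KZ.openOrderedSimplex n := by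
  constructor
  · rintro ⟨t, ht, rfl⟩
    dsimp only
    rw [permMatrix_mulVec_add_zero]
    convert ht using 1
    ext i
    simp
  · intro hy
    refine ⟨y ∘ σ.symm, hy, ?_⟩
    dsimp only
    rw [permMatrix_mulVec_add_zero]
    ext i
    simp

/-- The permuted open ordered simplex is the preimage of `Δ_n` under the coordinate permutation
`y ↦ y ∘ σ⁻¹`. [folklore] -/
theorem image_permMatrix_eq_preimage (σ : Equiv.Perm (Fin n)) :
    (fun x => (Equiv.Perm.permMatrix ℝ σ : Matrix (Fin n) (Fin n) ℝ).mulVec x + 0) ''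
        KZ.openOrderedSimplex n =
      (fun y : Fin n → ℝ => y ∘ σ.symm) ⁻¹' KZ.openOrderedSimplex n :=
  Set.ext fun y => mem_image_permMatrix_iff σ y

/-- The permuted open ordered simplex is `ℚ`-semialgebraic (a coordinate-permutation preimage of
the `ℚ`-semialgebraic `Δ_n`). [cite: BochnakCosteRoy1998, §2.1] -/
theorem isSemialgebraic_image_permMatrix (σ : Equiv.Perm (Fin n)) :
    IsSemialgebraic ℚ
      ((fun x => (Equiv.Perm.permMatrix ℝ σ : Matrix (Fin n) (Fin n) ℝ).mulVec x + 0) ''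
        KZ.openOrderedSimplex n) := by
  rw [image_permMatrix_eq_preimage]
  exact (KZ.isSemialgebraic_openOrderedSimplex n).preimage_comp σ.symm

/-- The permuted open ordered simplex lies in the open cube `(0,1)ⁿ`. [folklore] -/
theorem image_permMatrix_subset_cube (σ : Equiv.Perm (Fin n)) :
    (fun x => (Equiv.Perm.permMatrix ℝ σ : Matrix (Fin n) (Fin n) ℝ).mulVec x + 0) ''
        KZ.openOrderedSimplex n ⊆ Set.pi Set.univ (fun _ => Set.Ioo (0 : ℝ) 1) := by
  rintro _ ⟨t, ht, rfl⟩
  dsimp only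
  rw [permMatrix_mulVec_add_zero]
  exact Set.mem_univ_pi.mpr fun i => ⟨ht.1 (σ i), ht.2.1 (σ i)⟩

/-- **Cover.** A point of the cube with pairwise distinct coordinates lies in the permuted simplex
`P_σ Δ_n` for `σ` the inverse of its decreasing sorting permutation `(Tuple.sort x) ∘ Fin.rev`.
[folklore] -/
theorem exists_mem_image_permMatrix {x : Fin n → ℝ}
    (hx : x ∈ Set.pi Set.univ (fun _ => Set.Ioo (0 : ℝ) 1)) (hinj : Function.Injective x) :
    ∃ σ : Equiv.Perm (Fin n),
      x ∈ (fun x => (Equiv.Perm.permMatrix ℝ σ : Matrix (Fin n) (Fin n) ℝ).mulVec x + 0) ''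
        KZ.openOrderedSimplex n := by
  set ρ : Equiv.Perm (Fin n) := Fin.revPerm.trans (Tuple.sort x) with hρ
  refine ⟨ρ.symm, (mem_image_permMatrix_iff _ _).mpr ?_⟩
  rw [Equiv.symm_symm]
  have hmono : StrictMono (x ∘ Tuple.sort x) :=
    (Tuple.monotone_sort x).strictMono_of_injective (hinj.comp (Tuple.sort x).injective)
  have hanti : StrictAnti (x ∘ ρ) := by
    have : x ∘ ⇑ρ = (x ∘ Tuple.sort x) ∘ Fin.rev := by
      ext i
      simp [hρ]
    rw [this]
    exact hmono.comp_strictAnti Fin.rev_strictAnti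
  have hx' := Set.mem_univ_pi.mp hx
  exact ⟨fun i => (hx' (ρ i)).1, fun i => (hx' (ρ i)).2, hanti⟩

/-- The cover defect of the cube by the `n!` permuted simplices lies in the union of the diagonal
hyperplanes `{x | x i = x j}` (`i ≠ j`). [folklore] -/
theorem cube_diff_iUnion_subset :
    Set.pi Set.univ (fun _ => Set.Ioo (0 : ℝ) 1) \
        ⋃ σ ∈ (Finset.univ : Finset (Equiv.Perm (Fin n))),
          (fun x => (Equiv.Perm.permMatrix ℝ σ : Matrix (Fin n) (Fin n) ℝ).mulVec x + 0) ''
            KZ.openOrderedSimplex n ⊆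
      ⋃ p : Fin n × Fin n, {w : Fin n → ℝ | p.1 ≠ p.2 ∧ w p.1 = w p.2} := by
  rintro x ⟨hx, hxU⟩
  by_contra hne
  have hinj : Function.Injective x := by
    intro a b hab
    by_contra h
    exact hne (Set.mem_iUnion.mpr ⟨(a, b), h, hab⟩)
  obtain ⟨σ, hσ⟩ := exists_mem_image_permMatrix hx hinj
  exact hxU (Set.mem_iUnion₂.mpr ⟨σ, Finset.mem_univ _, hσ⟩)

/-- The union of the diagonal hyperplanes `{x | x i = x j}` (`i ≠ j`) of `ℝⁿ` is Lebesgue-null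
(`KZ.volume_setOf_apply_eq_apply`). [folklore] -/
theorem volume_iUnion_diagonal :
    volume (⋃ p : Fin n × Fin n, {w : Fin n → ℝ | p.1 ≠ p.2 ∧ w p.1 = w p.2}) = 0 := by
  refine measure_iUnion_null fun p => ?_
  rcases eq_or_ne p.1 p.2 with hp | hp
  · have : {w : Fin n → ℝ | p.1 ≠ p.2 ∧ w p.1 = w p.2} = ∅ := by
      ext w
      simp [hp]
    rw [this, measure_empty]
  · exact measure_mono_null (fun w hw => hw.2) (KZ.volume_setOf_apply_eq_apply hp)

/-- **The permuted simplices cover the cube up to a null set.** [folklore] -/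
theorem volume_cube_diff_iUnion :
    volume (Set.pi Set.univ (fun _ => Set.Ioo (0 : ℝ) 1) \
        ⋃ σ ∈ (Finset.univ : Finset (Equiv.Perm (Fin n))),
          (fun x => (Equiv.Perm.permMatrix ℝ σ : Matrix (Fin n) (Fin n) ℝ).mulVec x + 0) ''
            KZ.openOrderedSimplex n) = 0 :=
  measure_mono_null cube_diff_iUnion_subset volume_iUnion_diagonal

/-- **Disjointness.** Distinct permutations give disjoint permuted simplices: if `y ∘ σ⁻¹` and
`y ∘ σ'⁻¹` are both strictly decreasing then `y` has distinct entries and its decreasing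
enumeration is unique (`Tuple.unique_monotone` after reversal by `Fin.rev`), so `σ = σ'`.
[folklore] -/
theorem image_permMatrix_inter_eq_empty {σ σ' : Equiv.Perm (Fin n)} (h : σ ≠ σ') :
    (fun x => (Equiv.Perm.permMatrix ℝ σ : Matrix (Fin n) (Fin n) ℝ).mulVec x + 0) ''
          KZ.openOrderedSimplex n ∩
        (fun x => (Equiv.Perm.permMatrix ℝ σ' : Matrix (Fin n) (Fin n) ℝ).mulVec x + 0) ''
          KZ.openOrderedSimplex n = ∅ := by
  refine Set.eq_empty_of_forall_notMem fun y hy => h ?_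
  obtain ⟨hy, hy'⟩ := hy
  rw [mem_image_permMatrix_iff] at hy hy'
  have hmono : ∀ τ : Equiv.Perm (Fin n), y ∘ τ.symm ∈ KZ.openOrderedSimplex n →
      Monotone (y ∘ ⇑(Fin.revPerm.trans τ.symm)) := by
    intro τ hτ
    have : y ∘ ⇑(Fin.revPerm.trans τ.symm) = (y ∘ τ.symm) ∘ Fin.rev := by
      ext i
      simp
    rw [this]
    exact (hτ.2.2.comp Fin.rev_strictAnti).monotone
  have heq := Tuple.unique_monotone (hmono σ hy) (hmono σ' hy')
  have hinj : Function.Injective y := hy.2.2.injective.of_comp_right σ.symm.surjective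
  refine Equiv.ext fun i => ?_
  have hi := congrFun heq (Fin.rev (σ i))
  simp only [Function.comp_apply, Equiv.coe_trans, Fin.revPerm_apply, Fin.rev_rev,
    Equiv.symm_apply_apply] at hi
  have hi' : σ'.symm (σ i) = i := (hinj hi).symm
  rw [Equiv.symm_apply_eq] at hi'
  exact hi'

end CubeTriangulation

/-- **CUBE TRIANGULATION** (stub 60 of line `Sketch`): a representation `r` over the open cube
`(0,1)ⁿ` is covered, up to the null walls `{xᵢ = xⱼ}`, by its honest restrictions
`R σ := r|_{P_σ Δ_n}` to the `n!` permuted open ordered simplices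
`P_σ Δ_n = (x ↦ P_σ x + 0) '' Δ_n` (same integrand, domains inside the cube, pairwise disjoint).
[folklore] -/
theorem tateLifting_cubeTriangulation :
  ∀ (n : ℕ) (r : KZ.IntegralRep n), r.domain = Set.pi Set.univ (fun _ => Set.Ioo (0 : ℝ) 1) →
    ∃ R : Equiv.Perm (Fin n) → KZ.IntegralRep n,
      (∀ σ, (R σ).domain =
        (fun x => ((Equiv.Perm.permMatrix ℝ σ : Matrix (Fin n) (Fin n) ℝ)).mulVec x + 0) '' KZ.openOrderedSimplex n) ∧
      (∀ σ, (R σ).integrand = r.integrand) ∧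
      (∀ σ, (R σ).domain ⊆ r.domain) ∧
      volume (r.domain \ ⋃ σ ∈ (Finset.univ : Finset (Equiv.Perm (Fin n))), (R σ).domain) = 0 ∧
      ((Finset.univ : Finset (Equiv.Perm (Fin n))) : Set (Equiv.Perm (Fin n))).Pairwise
        (fun σ σ' => volume ((R σ).domain ∩ (R σ').domain) = 0) := by
  intro n r hr
  have hsub : ∀ σ : Equiv.Perm (Fin n),
      (fun x => (Equiv.Perm.permMatrix ℝ σ : Matrix (Fin n) (Fin n) ℝ).mulVec x + 0) ''
        KZ.openOrderedSimplex n ⊆ r.domain := fun σ => by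
    rw [hr]
    exact CubeTriangulation.image_permMatrix_subset_cube σ
  refine ⟨fun σ => r.restrict _ (CubeTriangulation.isSemialgebraic_image_permMatrix σ)
      (hsub σ), fun σ => rfl, fun σ => rfl, hsub, ?_, ?_⟩
  · -- the cover defect lies in the (null) union of the diagonal hyperplanes
    simp only [KZ.IntegralRep.domain_restrict]
    rw [hr]
    exact CubeTriangulation.volume_cube_diff_iUnion
  · -- distinct permuted simplices are disjoint
    intro σ _ σ' _ hne
    simp only [KZ.IntegralRep.domain_restrict]
    rw [CubeTriangulation.image_permMatrix_inter_eq_empty hne, measure_empty]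

end Summit.KontsevichZagierPeriods.InverseLandau
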